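import Summits.CriticalPhenomena.PercolationContinuityZ3.Theorems.PercNearOneGluingNoHeavyQuantAtMostOneAnalytic
import HarnessLib

/-!
# QUANT lane R8 — the envelope inequality for `r = 2`: `E(n, 2, y) ≤ 1` for all `n ≥ 5`, `0 ≤ y ≤ 1/2`

builds on p205010 (kernel theorem, internal audit signed; external expert review pending)

Support file (`--supports stmt-CriticalPhenomena-4575`), QUANT lane typer seat prim-quant-stmt (gen 20).  Theorems only (real analysis).  Discharges, for
`r = 2`, the envelope hypothesis of `…QuantAtMostRBound` (`amr_le_of_credit`, `tail_ge_of_tied_general`):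
`E(n, 2, y) = y^{n−1} b^n + n·y^{n−2}(1 − y/2)·b^{n−1} + C(n,2)·y^{n−3}(1 − y/2)²·b^{n−2} ≤ 1`, `b = 2 − y − 4/n` — so "at least THREE of `n`"
(`P(X ≤ 2) ≤ 1 − x` whenever the credit rates sum to `≥ 4`) and DIB\* for tied blobs of size `s` with `2s ≤ j < 3s` become kernel theorems once the
two files are combined (`…QuantTiedThree`).

Proof: `n = 5` — `1 − E(5, y)` is a degree-9 polynomial with positive Bernstein coefficients on `[0, 1/2]` (minimum `0.33`); `n ≥ 6` — on `[0, 3/10]`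
bound `(1 − y/2)^i ≤ 1` and move `y` to `3/10` (`pow_mul_pow_le_endpoint`), on `[3/10, 1/2]` bound `(1 − y/2)^i ≤ (17/20)^i` and move `y` to `1/2`; the
resulting numbers `P₁(n) ≤ 0.522`, `P₂(n) ≤ 0.792` are evaluated for `n ≤ 11` / `n ≤ 25` and bounded by `(17/10) n² (51/100)^{n−3}` / `n² (3/4)^{n−3}`
beyond.  Numerics: `sup_y E(n,2,y) = 0.6397` at `n = 5`, `y ≈ 0.42` (seat folder).  [this work]
-/

namespace Summit.CriticalPhenomena.PercolationContinuityZ3.Theorems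

namespace Quant

namespace IndepBlob

open Finset

/-! ### 1. Crude tails -/

/-- `(17/10)·n²·(51/100)^{n−3} ≤ 1` for `n ≥ 12` (stated with `n = m + 3`). [this work] -/
theorem crudeOne_le_one (m : ℕ) (hm : 9 ≤ m) : (17 / 10 : ℝ) * ((m : ℝ) + 3) ^ 2 * (51 / 100) ^ m ≤ 1 := by
  induction m, hm using Nat.le_induction with
  | base => norm_num
  | succ m hm ih =>
    have hm' : (9 : ℝ) ≤ m := by exact_mod_cast hm
    have e : (17 / 10 : ℝ) * (((m + 1 : ℕ) : ℝ) + 3) ^ 2 * (51 / 100) ^ (m + 1) =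
        ((17 / 10 : ℝ) * ((m : ℝ) + 3) ^ 2 * (51 / 100) ^ m) * ((51 / 100) * (((m : ℝ) + 4) / ((m : ℝ) + 3)) ^ 2) := by
      push_cast; field_simp; ring
    rw [e]
    have hr : (51 / 100 : ℝ) * (((m : ℝ) + 4) / ((m : ℝ) + 3)) ^ 2 ≤ 1 := by
      rw [div_pow, ← mul_div_assoc, div_le_one (by positivity)]; nlinarith
    have hpos : 0 ≤ (17 / 10 : ℝ) * ((m : ℝ) + 3) ^ 2 * (51 / 100) ^ m := by positivity
    calc _ ≤ 1 * ((51 / 100 : ℝ) * (((m : ℝ) + 4) / ((m : ℝ) + 3)) ^ 2) := mul_le_mul_of_nonneg_right ih (by positivity)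
      _ ≤ 1 := by rw [one_mul]; exact hr

/-- `n²·(3/4)^{n−3} ≤ 1` for `n ≥ 26` (stated with `n = m + 3`). [this work] -/
theorem crudeTwo_le_one (m : ℕ) (hm : 23 ≤ m) : (((m : ℝ) + 3) ^ 2) * (3 / 4 : ℝ) ^ m ≤ 1 := by
  induction m, hm using Nat.le_induction with
  | base => norm_num
  | succ m hm ih =>
    have hm' : (23 : ℝ) ≤ m := by exact_mod_cast hm
    have e : (((m + 1 : ℕ) : ℝ) + 3) ^ 2 * (3 / 4 : ℝ) ^ (m + 1) =
        ((((m : ℝ) + 3) ^ 2) * (3 / 4 : ℝ) ^ m) * ((3 / 4) * (((m : ℝ) + 4) / ((m : ℝ) + 3)) ^ 2) := by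
      push_cast; field_simp; ring
    rw [e]
    have hr : (3 / 4 : ℝ) * (((m : ℝ) + 4) / ((m : ℝ) + 3)) ^ 2 ≤ 1 := by
      rw [div_pow, ← mul_div_assoc, div_le_one (by positivity)]; nlinarith
    have hpos : 0 ≤ (((m : ℝ) + 3) ^ 2) * (3 / 4 : ℝ) ^ m := by positivity
    calc _ ≤ 1 * ((3 / 4 : ℝ) * (((m : ℝ) + 4) / ((m : ℝ) + 3)) ^ 2) := mul_le_mul_of_nonneg_right ih (by positivity)
      _ ≤ 1 := by rw [one_mul]; exact hr

/-! ### 2. The two frozen sums `P₁(n)`, `P₂(n)` -/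

/-- `P₁(n) = Σ_{i ≤ 2} C(n,i)(3/10)^{n−1−i}(17/10 − 4/n)^{n−i} ≤ 1` for `n ≥ 6` (stated with `n = m + 3`). [this work] -/
theorem pOne_le_one (m : ℕ) (hm : 3 ≤ m) :
    (3 / 10 : ℝ) ^ (m + 2) * (17 / 10 - 4 / ((m : ℝ) + 3)) ^ (m + 3) +
      ((m : ℝ) + 3) * (3 / 10 : ℝ) ^ (m + 1) * (17 / 10 - 4 / ((m : ℝ) + 3)) ^ (m + 2) +
      ((m : ℝ) + 3) * ((m : ℝ) + 2) / 2 * (3 / 10 : ℝ) ^ m * (17 / 10 - 4 / ((m : ℝ) + 3)) ^ (m + 1) ≤ 1 := by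
  by_cases h9 : 9 ≤ m
  · have hm0 : (0 : ℝ) ≤ m := Nat.cast_nonneg m
    have hB : (17 / 10 - 4 / ((m : ℝ) + 3)) ≤ 17 / 10 := by
      have : 0 ≤ 4 / ((m : ℝ) + 3) := by positivity
      linarith
    have hB0 : 0 ≤ 17 / 10 - 4 / ((m : ℝ) + 3) := by
      rw [sub_nonneg, div_le_iff₀ (by positivity)]; nlinarith
    have h1 : (17 / 10 - 4 / ((m : ℝ) + 3)) ^ (m + 3) ≤ (17 / 10 : ℝ) ^ (m + 3) := pow_le_pow_left₀ hB0 hB _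
    have h2 : (17 / 10 - 4 / ((m : ℝ) + 3)) ^ (m + 2) ≤ (17 / 10 : ℝ) ^ (m + 2) := pow_le_pow_left₀ hB0 hB _
    have h3 : (17 / 10 - 4 / ((m : ℝ) + 3)) ^ (m + 1) ≤ (17 / 10 : ℝ) ^ (m + 1) := pow_le_pow_left₀ hB0 hB _
    have hc := crudeOne_le_one m h9
    have e : (3 / 10 : ℝ) ^ (m + 2) * (17 / 10 : ℝ) ^ (m + 3) + ((m : ℝ) + 3) * (3 / 10 : ℝ) ^ (m + 1) * (17 / 10 : ℝ) ^ (m + 2) +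
        ((m : ℝ) + 3) * ((m : ℝ) + 2) / 2 * (3 / 10 : ℝ) ^ m * (17 / 10 : ℝ) ^ (m + 1) =
        (17 / 10 : ℝ) * (51 / 100) ^ m * ((9 / 100) * (289 / 100) + (3 / 10) * (17 / 10) * ((m : ℝ) + 3) + ((m : ℝ) + 3) * ((m : ℝ) + 2) / 2) := by
      have : (51 / 100 : ℝ) ^ m = (3 / 10 : ℝ) ^ m * (17 / 10) ^ m := by rw [← mul_pow]; norm_num
      rw [this]; ring
    have hq : (9 / 100 : ℝ) * (289 / 100) + (3 / 10) * (17 / 10) * ((m : ℝ) + 3) + ((m : ℝ) + 3) * ((m : ℝ) + 2) / 2 ≤ ((m : ℝ) + 3) ^ 2 := by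
      nlinarith
    have hp0 : 0 ≤ (3 / 10 : ℝ) ^ (m + 2) := by positivity
    have hp1 : 0 ≤ ((m : ℝ) + 3) * (3 / 10 : ℝ) ^ (m + 1) := by positivity
    have hp2 : 0 ≤ ((m : ℝ) + 3) * ((m : ℝ) + 2) / 2 * (3 / 10 : ℝ) ^ m := by positivity
    calc _ ≤ (3 / 10 : ℝ) ^ (m + 2) * (17 / 10 : ℝ) ^ (m + 3) + ((m : ℝ) + 3) * (3 / 10 : ℝ) ^ (m + 1) * (17 / 10 : ℝ) ^ (m + 2) +
          ((m : ℝ) + 3) * ((m : ℝ) + 2) / 2 * (3 / 10 : ℝ) ^ m * (17 / 10 : ℝ) ^ (m + 1) := by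
          nlinarith [mul_le_mul_of_nonneg_left h1 hp0, mul_le_mul_of_nonneg_left h2 hp1, mul_le_mul_of_nonneg_left h3 hp2]
      _ = (17 / 10 : ℝ) * (51 / 100) ^ m * ((9 / 100) * (289 / 100) + (3 / 10) * (17 / 10) * ((m : ℝ) + 3) + ((m : ℝ) + 3) * ((m : ℝ) + 2) / 2) := e
      _ ≤ (17 / 10 : ℝ) * (51 / 100) ^ m * ((m : ℝ) + 3) ^ 2 := mul_le_mul_of_nonneg_left hq (by positivity)
      _ = (17 / 10 : ℝ) * ((m : ℝ) + 3) ^ 2 * (51 / 100) ^ m := by ring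
      _ ≤ 1 := hc
  · interval_cases m <;> norm_num

/-- `P₂(n) = Σ_{i ≤ 2} C(n,i)(1/2)^{n−1−i}(17/20)^i(3/2 − 4/n)^{n−i} ≤ 1` for `n ≥ 6` (stated with `n = m + 3`). [this work] -/
theorem pTwo_le_one (m : ℕ) (hm : 3 ≤ m) :
    (1 / 2 : ℝ) ^ (m + 2) * (3 / 2 - 4 / ((m : ℝ) + 3)) ^ (m + 3) +
      ((m : ℝ) + 3) * (1 / 2 : ℝ) ^ (m + 1) * (17 / 20) * (3 / 2 - 4 / ((m : ℝ) + 3)) ^ (m + 2) +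
      ((m : ℝ) + 3) * ((m : ℝ) + 2) / 2 * (1 / 2 : ℝ) ^ m * (17 / 20) ^ 2 * (3 / 2 - 4 / ((m : ℝ) + 3)) ^ (m + 1) ≤ 1 := by
  by_cases h23 : 23 ≤ m
  · have hm0 : (0 : ℝ) ≤ m := Nat.cast_nonneg m
    have hB : (3 / 2 - 4 / ((m : ℝ) + 3)) ≤ 3 / 2 := by
      have : 0 ≤ 4 / ((m : ℝ) + 3) := by positivity
      linarith
    have hB0 : 0 ≤ 3 / 2 - 4 / ((m : ℝ) + 3) := by
      rw [sub_nonneg, div_le_iff₀ (by positivity)]; nlinarith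
    have h1 : (3 / 2 - 4 / ((m : ℝ) + 3)) ^ (m + 3) ≤ (3 / 2 : ℝ) ^ (m + 3) := pow_le_pow_left₀ hB0 hB _
    have h2 : (3 / 2 - 4 / ((m : ℝ) + 3)) ^ (m + 2) ≤ (3 / 2 : ℝ) ^ (m + 2) := pow_le_pow_left₀ hB0 hB _
    have h3 : (3 / 2 - 4 / ((m : ℝ) + 3)) ^ (m + 1) ≤ (3 / 2 : ℝ) ^ (m + 1) := pow_le_pow_left₀ hB0 hB _
    have hc := crudeTwo_le_one m h23
    have e : (1 / 2 : ℝ) ^ (m + 2) * (3 / 2 : ℝ) ^ (m + 3) + ((m : ℝ) + 3) * (1 / 2 : ℝ) ^ (m + 1) * (17 / 20) * (3 / 2 : ℝ) ^ (m + 2) +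
        ((m : ℝ) + 3) * ((m : ℝ) + 2) / 2 * (1 / 2 : ℝ) ^ m * (17 / 20) ^ 2 * (3 / 2 : ℝ) ^ (m + 1) =
        (3 / 4 : ℝ) ^ m * ((1 / 4) * (27 / 8) + (1 / 2) * (17 / 20) * (9 / 4) * ((m : ℝ) + 3) +
          (17 / 20) ^ 2 * (3 / 2) * (((m : ℝ) + 3) * ((m : ℝ) + 2) / 2)) := by
      have : (3 / 4 : ℝ) ^ m = (1 / 2 : ℝ) ^ m * (3 / 2) ^ m := by rw [← mul_pow]; norm_num
      rw [this]; ring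
    have hq : (1 / 4 : ℝ) * (27 / 8) + (1 / 2) * (17 / 20) * (9 / 4) * ((m : ℝ) + 3) +
        (17 / 20) ^ 2 * (3 / 2) * (((m : ℝ) + 3) * ((m : ℝ) + 2) / 2) ≤ ((m : ℝ) + 3) ^ 2 := by
      nlinarith
    have hp0 : 0 ≤ (1 / 2 : ℝ) ^ (m + 2) := by positivity
    have hp1 : 0 ≤ ((m : ℝ) + 3) * (1 / 2 : ℝ) ^ (m + 1) * (17 / 20) := by positivity
    have hp2 : 0 ≤ ((m : ℝ) + 3) * ((m : ℝ) + 2) / 2 * (1 / 2 : ℝ) ^ m * (17 / 20) ^ 2 := by positivity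
    calc _ ≤ (1 / 2 : ℝ) ^ (m + 2) * (3 / 2 : ℝ) ^ (m + 3) + ((m : ℝ) + 3) * (1 / 2 : ℝ) ^ (m + 1) * (17 / 20) * (3 / 2 : ℝ) ^ (m + 2) +
          ((m : ℝ) + 3) * ((m : ℝ) + 2) / 2 * (1 / 2 : ℝ) ^ m * (17 / 20) ^ 2 * (3 / 2 : ℝ) ^ (m + 1) := by
          nlinarith [mul_le_mul_of_nonneg_left h1 hp0, mul_le_mul_of_nonneg_left h2 hp1, mul_le_mul_of_nonneg_left h3 hp2]
      _ = (3 / 4 : ℝ) ^ m * ((1 / 4) * (27 / 8) + (1 / 2) * (17 / 20) * (9 / 4) * ((m : ℝ) + 3) +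
          (17 / 20) ^ 2 * (3 / 2) * (((m : ℝ) + 3) * ((m : ℝ) + 2) / 2)) := e
      _ ≤ (3 / 4 : ℝ) ^ m * ((m : ℝ) + 3) ^ 2 := mul_le_mul_of_nonneg_left hq (by positivity)
      _ = (((m : ℝ) + 3) ^ 2) * (3 / 4 : ℝ) ^ m := by ring
      _ ≤ 1 := hc
  · interval_cases m <;> norm_num

/-! ### 3. The envelope inequality for `r = 2` -/

/-- `n = 5`: `1 − E(5, y) ≥ 0` on `[0, 1/2]` — a degree-9 polynomial with positive Bernstein coefficients (`linarith`/`nlinarith` over the products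
`y^k (1/2 − y)^{9−k}`). [this work] -/
theorem envelopeTwo_five (y : ℝ) (hy0 : 0 ≤ y) (hy : y ≤ 1 / 2) :
    y ^ 4 * (6 / 5 - y) ^ 5 + 5 * y ^ 3 * (1 - y / 2) * (6 / 5 - y) ^ 4 + 10 * y ^ 2 * (1 - y / 2) ^ 2 * (6 / 5 - y) ^ 3 ≤ 1 := by
  have h : 0 ≤ 1 / 2 - y := by linarith
  nlinarith [mul_nonneg (pow_nonneg hy0 9) (pow_nonneg h 0), mul_nonneg (pow_nonneg hy0 8) (pow_nonneg h 1),
    mul_nonneg (pow_nonneg hy0 7) (pow_nonneg h 2), mul_nonneg (pow_nonneg hy0 6) (pow_nonneg h 3),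
    mul_nonneg (pow_nonneg hy0 5) (pow_nonneg h 4), mul_nonneg (pow_nonneg hy0 4) (pow_nonneg h 5),
    mul_nonneg (pow_nonneg hy0 3) (pow_nonneg h 6), mul_nonneg (pow_nonneg hy0 2) (pow_nonneg h 7),
    mul_nonneg (pow_nonneg hy0 1) (pow_nonneg h 8), mul_nonneg (pow_nonneg hy0 0) (pow_nonneg h 9)]

/-- `n = m + 3 ≥ 6`: the two-interval argument. [this work] -/
theorem envelopeTwo_ge_six (m : ℕ) (hge : 3 ≤ m) (y : ℝ) (hy0 : 0 ≤ y) (hy : y ≤ 1 / 2) :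
    y ^ (m + 2) * ((2 - 4 / ((m : ℝ) + 3)) - y) ^ (m + 3) + ((m : ℝ) + 3) * y ^ (m + 1) * (1 - y / 2) * ((2 - 4 / ((m : ℝ) + 3)) - y) ^ (m + 2) +
      ((m : ℝ) + 3) * ((m : ℝ) + 2) / 2 * y ^ m * (1 - y / 2) ^ 2 * ((2 - 4 / ((m : ℝ) + 3)) - y) ^ (m + 1) ≤ 1 := by
  set A : ℝ := 2 - 4 / ((m : ℝ) + 3) with hAval
  have hm0 : (0 : ℝ) ≤ m := Nat.cast_nonneg m
  have hm3 : (0 : ℝ) < (m : ℝ) + 3 := by positivity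
  have hm3' : (3 : ℝ) ≤ m := by exact_mod_cast hge
  have h4 : 4 / ((m : ℝ) + 3) ≤ 2 / 3 := by rw [div_le_iff₀ hm3]; linarith
  have h4' : 0 ≤ 4 / ((m : ℝ) + 3) := by positivity
  have hA_lo : 4 / 3 ≤ A := by rw [hAval]; linarith
  have hA_hi : A ≤ 2 := by rw [hAval]; linarith
  have hv0 : 0 ≤ 1 - y / 2 := by linarith
  have hAy : 0 ≤ A - y := by linarith
  have hyA1 : 0 ≤ y ^ (m + 1) * (A - y) ^ (m + 2) := by positivity
  have hyA2 : 0 ≤ y ^ m * (A - y) ^ (m + 1) := by positivity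
  have hmA : (m : ℝ) * (4 / 3) ≤ (m : ℝ) * A := mul_le_mul_of_nonneg_left hA_lo hm0
  by_cases hy1 : y ≤ 3 / 10
  · -- part 1: move `y` up to `3/10`, bound `(1 − y/2)^i ≤ 1`
    have hv1 : 1 - y / 2 ≤ 1 := by linarith
    have hlt : (3 / 10 : ℝ) < A := by linarith
    have hE0 := pow_mul_pow_le_endpoint (m + 2) (m + 3) A y (3 / 10) hy0 hy1 (by norm_num) hlt
      (by push_cast; linarith [hmA, hA_lo, hm3'])
    have hE1 := pow_mul_pow_le_endpoint (m + 1) (m + 2) A y (3 / 10) hy0 hy1 (by norm_num) hlt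
      (by push_cast; linarith [hmA, hA_lo, hm3'])
    have hE2 := pow_mul_pow_le_endpoint m (m + 1) A y (3 / 10) hy0 hy1 (by norm_num) hlt
      (by push_cast; linarith [hmA, hA_lo, hm3'])
    have hP := pOne_le_one m hge
    have eA : A - 3 / 10 = 17 / 10 - 4 / ((m : ℝ) + 3) := by rw [hAval]; ring
    rw [eA] at hE0 hE1 hE2
    have hB1 : 0 ≤ 17 / 10 - 4 / ((m : ℝ) + 3) := by linarith
    have h310 : (0 : ℝ) ≤ 3 / 10 := by norm_num
    have hQ1 := mul_nonneg (pow_nonneg h310 (m + 1)) (pow_nonneg hB1 (m + 2))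
    have hQ2 := mul_nonneg (pow_nonneg h310 m) (pow_nonneg hB1 (m + 1))
    have t1a : y ^ (m + 1) * (A - y) ^ (m + 2) * (1 - y / 2) ≤ (3 / 10 : ℝ) ^ (m + 1) * (17 / 10 - 4 / ((m : ℝ) + 3)) ^ (m + 2) := by
      have h := mul_le_mul_of_nonneg_left hv1 hyA1
      linarith
    have t2a : y ^ m * (A - y) ^ (m + 1) * (1 - y / 2) ^ 2 ≤ (3 / 10 : ℝ) ^ m * (17 / 10 - 4 / ((m : ℝ) + 3)) ^ (m + 1) := by
      have hv2 : (1 - y / 2) ^ 2 ≤ 1 := by nlinarith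
      have h := mul_le_mul_of_nonneg_left hv2 hyA2
      linarith
    have t1 := mul_le_mul_of_nonneg_left t1a hm3.le
    have hm32 : (0 : ℝ) ≤ ((m : ℝ) + 3) * ((m : ℝ) + 2) / 2 := by positivity
    have t2 := mul_le_mul_of_nonneg_left t2a hm32
    have e1 : ((m : ℝ) + 3) * y ^ (m + 1) * (1 - y / 2) * (A - y) ^ (m + 2) =
        ((m : ℝ) + 3) * (y ^ (m + 1) * (A - y) ^ (m + 2) * (1 - y / 2)) := by ring
    have e2 : ((m : ℝ) + 3) * ((m : ℝ) + 2) / 2 * y ^ m * (1 - y / 2) ^ 2 * (A - y) ^ (m + 1) =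
        ((m : ℝ) + 3) * ((m : ℝ) + 2) / 2 * (y ^ m * (A - y) ^ (m + 1) * (1 - y / 2) ^ 2) := by ring
    rw [e1, e2]
    linarith [hE0, t1, t2, hP]
  · -- part 2: `3/10 ≤ y ≤ 1/2`: move `y` up to `1/2`, bound `(1 − y/2) ≤ 17/20`
    push Not at hy1
    have hv1 : 1 - y / 2 ≤ 17 / 20 := by linarith
    have hlt : (1 / 2 : ℝ) < A := by linarith
    have hE0 := pow_mul_pow_le_endpoint (m + 2) (m + 3) A y (1 / 2) hy0 hy (by norm_num) hlt
      (by push_cast; linarith [hmA, hA_lo, hm3'])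
    have hE1 := pow_mul_pow_le_endpoint (m + 1) (m + 2) A y (1 / 2) hy0 hy (by norm_num) hlt
      (by push_cast; linarith [hmA, hA_lo, hm3'])
    have hE2 := pow_mul_pow_le_endpoint m (m + 1) A y (1 / 2) hy0 hy (by norm_num) hlt
      (by push_cast; linarith [hmA, hA_lo, hm3'])
    have hP := pTwo_le_one m hge
    have eA : A - 1 / 2 = 3 / 2 - 4 / ((m : ℝ) + 3) := by rw [hAval]; ring
    rw [eA] at hE0 hE1 hE2
    have hB0 : 0 ≤ 3 / 2 - 4 / ((m : ℝ) + 3) := by linarith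
    have h12 : (0 : ℝ) ≤ 1 / 2 := by norm_num
    have hF1 := mul_nonneg (pow_nonneg h12 (m + 1)) (pow_nonneg hB0 (m + 2))
    have hF2 := mul_nonneg (pow_nonneg h12 m) (pow_nonneg hB0 (m + 1))
    have t1a : y ^ (m + 1) * (A - y) ^ (m + 2) * (1 - y / 2) ≤
        (1 / 2 : ℝ) ^ (m + 1) * (3 / 2 - 4 / ((m : ℝ) + 3)) ^ (m + 2) * (17 / 20) := mul_le_mul hE1 hv1 hv0 hF1
    have hv2 : (1 - y / 2) ^ 2 ≤ (17 / 20 : ℝ) ^ 2 := pow_le_pow_left₀ hv0 hv1 2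
    have t2a : y ^ m * (A - y) ^ (m + 1) * (1 - y / 2) ^ 2 ≤
        (1 / 2 : ℝ) ^ m * (3 / 2 - 4 / ((m : ℝ) + 3)) ^ (m + 1) * (17 / 20 : ℝ) ^ 2 := mul_le_mul hE2 hv2 (pow_nonneg hv0 2) hF2
    have t1 := mul_le_mul_of_nonneg_left t1a hm3.le
    have hm32 : (0 : ℝ) ≤ ((m : ℝ) + 3) * ((m : ℝ) + 2) / 2 := by positivity
    have t2 := mul_le_mul_of_nonneg_left t2a hm32
    have e1 : ((m : ℝ) + 3) * y ^ (m + 1) * (1 - y / 2) * (A - y) ^ (m + 2) =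
        ((m : ℝ) + 3) * (y ^ (m + 1) * (A - y) ^ (m + 2) * (1 - y / 2)) := by ring
    have e2 : ((m : ℝ) + 3) * ((m : ℝ) + 2) / 2 * y ^ m * (1 - y / 2) ^ 2 * (A - y) ^ (m + 1) =
        ((m : ℝ) + 3) * ((m : ℝ) + 2) / 2 * (y ^ m * (A - y) ^ (m + 1) * (1 - y / 2) ^ 2) := by ring
    have e3 : ((m : ℝ) + 3) * (1 / 2 : ℝ) ^ (m + 1) * (17 / 20) * (3 / 2 - 4 / ((m : ℝ) + 3)) ^ (m + 2) =
        ((m : ℝ) + 3) * ((1 / 2 : ℝ) ^ (m + 1) * (3 / 2 - 4 / ((m : ℝ) + 3)) ^ (m + 2) * (17 / 20)) := by ring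
    have e4 : ((m : ℝ) + 3) * ((m : ℝ) + 2) / 2 * (1 / 2 : ℝ) ^ m * (17 / 20) ^ 2 * (3 / 2 - 4 / ((m : ℝ) + 3)) ^ (m + 1) =
        ((m : ℝ) + 3) * ((m : ℝ) + 2) / 2 * ((1 / 2 : ℝ) ^ m * (3 / 2 - 4 / ((m : ℝ) + 3)) ^ (m + 1) * (17 / 20 : ℝ) ^ 2) := by ring
    rw [e1, e2]
    rw [e3, e4] at hP
    linarith [hE0, t1, t2, hP]


/-- **`E(n, 2, y) ≤ 1`** for `n ≥ 5` and `0 ≤ y ≤ 1/2`: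
`y^{n−1}(2 − y − 4/n)^n + n·y^{n−2}(1 − y/2)(2 − y − 4/n)^{n−1} + C(n,2)·y^{n−3}(1 − y/2)²(2 − y − 4/n)^{n−2} ≤ 1` — the envelope hypothesis of
`…QuantAtMostRBound` at `r = 2`, in the syntactic form produced by `Finset.range (2+1)` there. [this work] -/
theorem envelopeTwo_le_one (n : ℕ) (hn : 5 ≤ n) (y : ℝ) (hy0 : 0 ≤ y) (hy : y ≤ 1 / 2) :
    ∑ i ∈ Finset.range (2 + 1), (n.choose i : ℝ) * y ^ (n - 1 - i) * (1 - y / 2) ^ i * (2 - y - 2 * (2 : ℝ) / n) ^ (n - i) ≤ 1 := by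
  obtain ⟨m, rfl⟩ : ∃ m, n = m + 3 := ⟨n - 3, by omega⟩
  have hm2 : 2 ≤ m := by omega
  rw [Finset.sum_range_succ, Finset.sum_range_succ, Finset.sum_range_one]
  have hc0 : ((m + 3).choose 0 : ℝ) = 1 := by simp
  have hc1 : ((m + 3).choose 1 : ℝ) = (m : ℝ) + 3 := by rw [Nat.choose_one_right]; push_cast; ring
  have hc2 : ((m + 3).choose 2 : ℝ) = ((m : ℝ) + 3) * ((m : ℝ) + 2) / 2 := by
    rw [Nat.choose_two_right]
    have h : ((m + 3) * (m + 3 - 1) / 2 : ℕ) * 2 = (m + 3) * (m + 2) := by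
      have := Nat.div_mul_cancel (Nat.even_mul_pred_self (m + 3)).two_dvd
      simpa using this
    have h' : (((m + 3) * (m + 3 - 1) / 2 : ℕ) : ℝ) * 2 = ((m : ℝ) + 3) * ((m : ℝ) + 2) := by exact_mod_cast h
    linarith
  have e0 : m + 3 - 1 - 0 = m + 2 := by omega
  have e1 : m + 3 - 1 - 1 = m + 1 := by omega
  have e2 : m + 3 - 1 - 2 = m := by omega
  have e3 : m + 3 - 0 = m + 3 := by omega
  have e4 : m + 3 - 1 = m + 2 := by omega
  have e5 : m + 3 - 2 = m + 1 := by omega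
  rw [hc0, hc1, hc2, e0, e1, e2, e3, e4, e5]
  have hmR : ((m + 3 : ℕ) : ℝ) = (m : ℝ) + 3 := by push_cast; ring
  rw [hmR]
  have hA' : ∀ t : ℝ, 2 - t - 2 * (2 : ℝ) / ((m : ℝ) + 3) = (2 - 4 / ((m : ℝ) + 3)) - t := fun t => by ring
  simp only [hA', pow_zero, pow_one, mul_one, one_mul]
  rcases Nat.lt_or_ge m 3 with hlt | hge
  · have hm : m = 2 := by omega
    subst hm
    have h := envelopeTwo_five y hy0 hy
    norm_num at h ⊢
    linarith
  · exact envelopeTwo_ge_six m hge y hy0 hy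

end IndepBlob

end Quant

end Summit.CriticalPhenomena.PercolationContinuityZ3.Theorems
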